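import Summits.BirchSwinnertonDyer.BirchSwinnertonDyer.Theses.ErratumRoadFive
import Summits.BirchSwinnertonDyer.BirchSwinnertonDyer.Theorems.ErratumRoadFiveOpenInputRung5835a1
import Summits.BirchSwinnertonDyer.BirchSwinnertonDyer.Theorems.ErratumRoadFiveIMCDivRung5235a1
import Summits.BirchSwinnertonDyer.BirchSwinnertonDyer.Theorems.ErratumRoadFiveIMCDivAtDiscrDefs

/-!
# BC3 birth skeleton — crux `ErratumRoadFive.IMCDivAtErratumDataAll` (item stmt-BirchSwinnertonDyer-19270, H3♭-all)

Route `route-BirchSwinnertonDyer-ErratumRoadFive` (rung K2, closes `X11b.MultiplicativeRankOne`), cell `bsd-stepL`,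
planner `bsd-stepL-plan` g25 (2026-08-26; v2 rung re-typed by g26; v3 rung CONCLUSION re-typed over the NAMED per-discriminant slice `P2.IMCDivIntCoreFrameAtDiscr` by g27 after imc-p1 g6's p458437). Registered form: named stubs `stub_*` (sorries ONLY there), stub
statements by name (`Statement.stub_*` via `type_of%`), the composition `IMCDivAtErratumDataAll_of` concluding the
ROUTE DECL by name (sorry-free, pure logic), and `IMCDivAtErratumDataAll_proof`.

The crux: at EVERY pair `(W, p)`, `P2.IMCDivIntCoreFrameAtErratumData W p` — per erratum datum (an odd non-split
`E[p]`-ramified multiplicative `q ≠ p`, an erratum field `K`, a Manin-good conductor-`N` parametrisation, a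
non-torsion Heegner point, an anticyclotomic `κ`, the prime of an embedding datum) a ♭-frame `(Ω_K ≠ 0, ‖Ω_p‖ = 1,
Q ∈ 𝓞_{ℂ_p}⟦T⟧)` with Castella's interpolation property and the ONE-SIDED divisibility
`Ch_Λ(X_ac^∅(E[p^∞]))·𝓞_{ℂ_p}⟦T⟧ ⊆ (Q)` [erratum (2.4) ⇐ Fouquet–Wan Thm. 4.41 + Hida descent, PREPRINT; claim
Castella2018Erratum under review]. The cut is by the REDUCTION TYPE AT `p` — the one distinction the descent from a
three-variable main conjecture to the anticyclotomic line actually reads: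

* `stub_imcDivErratum_nonsplitAtP` — `a_p = −1`: no exceptional zero of the BDP/Castella `p`-adic `L`-function at
  the trivial character; the descent (2.4) is the generic multiplicative case (Castella2018Erratum (2.4) with
  Skinner–Urban/Wan-type three-variable input [FouquetWan2021, Thm. 4.41], `U_p`-eigenvalue `−1`).
* `stub_imcDivErratum_splitAtP` — `a_p = +1`: the EXCEPTIONAL-ZERO case; the `p`-new BDP display of Castella
  JIMJ 2018 (Thms. 2.10–2.11, the tree's printed fact `Castella2018Exceptional.thm210_thm211_bdpDisplay_pNew`) and
  the 𝓛-invariant enter the interpolation factor `(1 − a_p p^{-1}·…)`; the divisibility needs the improved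
  (two-variable) `p`-adic `L`-function so that the trivial zero does not swallow the bound.
* `stub_rung_imcDivErratum_5235a1_d231` — the BC5 rung (T3), v3 (planner g27 after imc-p1 g6, 2026-08-26): the crux's
  CORE statement at the UNIT pair `(5235a1, 5)` for the erratum fields of discriminant `−231`, NOW CONCLUDING THE NAMED SLICE
  `P2.IMCDivIntCoreFrameAtDiscr E 5 (−231)` (imc-p1 g6, `Theorems/ErratumRoadFiveIMCDivAtDiscrDefs.lean`, p458437 ✓; the crux is
  `∀ d`, that slice: `P2.imcDivIntCoreFrameAtErratumData_iff_forall_atDiscr`), displayed over `h32` (Cas18 Thms. 3.1–3.2, published)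
  and the attested unit certificate at `d = −231` — exactly the hypotheses of the LANDED
  `P2.imcDivIntCoreFrameAtDiscr_of_thm32_of_unitCertAtDiscr h32 Rung5235a1.semistable hunit` (p458437 + p451721), hence closable by
  name with a one-line append. WHY v3: v2's rung spelled the slice's ∀-body out (header ≈ 5 000 chars) and the registry truncates
  `stubs[].signature` at 3 900 chars, so the by-name landing p457440 bounced `supports.stub-mismatch`; v3's header is ≈ 2 900 chars. v1's plan-only rung `stub_rung_imcDivErratum_5835a1` is WITHDRAWN as misstated-for-certification (kit j255076:
  `ord₅ log_ω(g) = 2` at 5835a1, the value is never a unit); the pieces S1/S2 and `IMCDivAtErratumDataAll_of` are byte-identical to v1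
  (registered 2026-08-26 by planner g25, sha16 of v1 in plan/D4/skel).

[cite: Castella2018Erratum, (2.4), Thm. 1.1 (pp. 1, 4)] [cite: Castella2018, Thm. 3.1, display (3.2) (arXiv:1704.06608 p. 9)]
[cite: Castella2018Exceptional, Thms. 2.10–2.11 (arXiv:1507.04260 pp. 13–14)] [cite: FouquetWan2021, Thm. 4.41 (arXiv:2107.13726)]
[cite: Cremona1997, Table 1 (curve 5835a1)]
-/

noncomputable section

open scoped Classical

namespace Summit.BirchSwinnertonDyer.BirchSwinnertonDyer.Cruxes.IMCDivAtErratumDataAll.Birth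

-- namespace opens exactly as in `Theorems/ErratumRoadFiveIMCDivRung5235a1.lean` (the rung stub's signature uses its short names)
open WeierstrassCurve NumberField IsDedekindDomain Field
open Literature.NumberTheory.EllipticCurves Literature.NumberTheory.EllipticCurves.GreenbergSelmer
open Literature.NumberTheory.EllipticCurves.ModularForms
open Literature.NumberTheory.EllipticCurves.Rank1Residual
open Literature.NumberTheory.EllipticCurves.Rank1Residual.Typed
open Literature.NumberTheory.EllipticCurves.Wuthrich2014
open Literature.NumberTheory.EllipticCurves.Castella2018
open Literature.NumberTheory.EllipticCurves.JetchevSkinnerWan2017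
open Literature.NumberTheory.GaloisRepresentations
open Literature.NumberTheory.GaloisCohomology
open Summit.BirchSwinnertonDyer.Rank1Residual Summit.BirchSwinnertonDyer.Rank1Residual.X11b
open Summit.BirchSwinnertonDyer.Rank1Residual.X11b.Halves Summit.BirchSwinnertonDyer.Rank1Residual.X11b.AcSelmer
open Summit.BirchSwinnertonDyer.BirchSwinnertonDyer.Rank1Residual.IntModel
open Summit.BirchSwinnertonDyer.BirchSwinnertonDyer.Theses

/-! ## Registered stubs -/

/-- **S1 · `stub_imcDivErratum_nonsplitAtP` — (2.4)♭ AT NON-SPLIT MULTIPLICATIVE `p`.** The one-sided integral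
core-frame divisibility at every erratum datum of a pair `(W, p)` with `W` NOT split multiplicative at `p` (inside
the crux's `ErratumHypotheses`, `p ∥ N`, so `a_p = −1`): the generic case of the descent, no exceptional zero.
[cite: Castella2018Erratum, (2.4)] [cite: FouquetWan2021, Thm. 4.41] -/
theorem stub_imcDivErratum_nonsplitAtP :
    ∀ (W : WeierstrassCurve ℚ) [W.IsElliptic] [W.IsGloballyMinimal] (p : ℕ) [Fact p.Prime],
      ¬ W.HasSplitMultiplicativeReductionAtPrime p →
      Summit.BirchSwinnertonDyer.Rank1Residual.X11b.P2.IMCDivIntCoreFrameAtErratumData W p := by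
  sorry

/-- **S2 · `stub_imcDivErratum_splitAtP` — (2.4)♭ AT SPLIT MULTIPLICATIVE `p` (EXCEPTIONAL ZERO).** The same
divisibility at every erratum datum of a pair with `W` split multiplicative at `p` (`a_p = +1`): the trivial zero of
the anticyclotomic `p`-adic `L`-function at `𝟙` must be divided out (Castella JIMJ18 `p`-new display, 𝓛-invariant)
before the descent bounds `Ch_Λ(X_ac)`. [cite: Castella2018Exceptional, Thms. 2.10–2.11] [cite: Castella2018Erratum, (2.4)] -/
theorem stub_imcDivErratum_splitAtP :
    ∀ (W : WeierstrassCurve ℚ) [W.IsElliptic] [W.IsGloballyMinimal] (p : ℕ) [Fact p.Prime],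
      W.HasSplitMultiplicativeReductionAtPrime p →
      Summit.BirchSwinnertonDyer.Rank1Residual.X11b.P2.IMCDivIntCoreFrameAtErratumData W p := by
  sorry

/-- **R1′ · `stub_rung_imcDivErratum_5235a1_d231` — CERTIFIED BC5 RUNG (piece S1), v3: conclusion = the NAMED per-discriminant slice
`Summit.BirchSwinnertonDyer.Rank1Residual.X11b.P2.IMCDivIntCoreFrameAtDiscr E 5 (-231)` (imc-p1 g6, p458437; re-typed by planner g27
2026-08-26T19:1xZ because the registry truncates stub signatures at 3 900 chars).** The crux's CORE statement (`P2.IMCDivIntCoreFrameAtErratumData E 5` = `∀ d`, the slice at `d`) at the UNIT pair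
`E = 5235a1 = [1,1,0,−113,−552]` (`N = 5235 = 3·5·349`, 5 and 3 NON-split multiplicative, `v₃(Δ_min) = 3`, (ram), (iv),
`ρ̄₅` onto, semistable — all KERNEL in `Theorems.Rung5235a1`), restricted to the erratum fields of discriminant `−231`, DISPLAYED
over exactly the two hypotheses the landed theorem `Summit.BirchSwinnertonDyer.BirchSwinnertonDyer.Theorems.Rung5235a1.imcDivIntCoreFrameAtDiscr_5235a1_5_of_thm32_of_unitCert`
(p451721 ✓) takes: `h32` = Castella 2018 Thms. 3.1–3.2 (PUBLISHED named fact, no `_holds`) and `hunit` = the ATTESTED unit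
certificate at `d = −231` («at every erratum datum of `(E,5)` over a field of discriminant `−231`, `‖(1 − a₅ 5⁻¹)·log_ω P‖ = 1`»;
kit j255217: `y_K = −2g + T`, `ord₅ log_ω(y_K) = ord₅ log_ω(g) = 1`, `#Ш(E^{−231})_an = 1`). With these binders the stub is closed BY NAME by the one-line term
`fun h32 hunit ↦ P2.imcDivIntCoreFrameAtDiscr_of_thm32_of_unitCertAtDiscr h32 Theorems.Rung5235a1.semistable hunit` (planner scratch
`byname-closability-19270-v3.lean`, farm rc 0). It REPLACES the misstated
plan-only rung `stub_rung_imcDivErratum_5835a1` (imc-p1 kit j255076: at 5835a1 the generator has `ord₅ log_ω(g) = 2`, the BDP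
value is never a 5-adic unit, so the unit-value shortcut cannot certify it; 5835a1 stays the route's outside-print witness pair via
`openInputOnTreeAt_5835a1_5_of_items`). Why outside S's known regime: `N = 5235 ≥ 5000` is beyond every printed per-curve
BSD verification, `p = 5 ∥ N` non-split lies on the withdrawn locus of Cas18 Thm. A, and no refereed source gives (2.4) at a
multiplicative pair; the lever exercised is the route's own (Castella's ♭-frame + one-sided divisibility), trivialised by a unit value.
Not used by `IMCDivAtErratumDataAll_of`. [cite: Castella2018, Thms. 3.1–3.2 (arXiv:1704.06608 p. 9)] [cite: Castella2018Erratum, (2.4)]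
[cite: Cremona1997, Table 1 (curve 5235a1)] -/
theorem stub_rung_imcDivErratum_5235a1_d231 [((⟨1, 1, 0, -113, -552⟩ : WeierstrassCurve ℤ).baseChange ℚ).IsElliptic] [((⟨1, 1, 0, -113, -552⟩ : WeierstrassCurve ℤ).baseChange ℚ).IsGloballyMinimal]
    (h32 : thm32_exists_isBDPLFunction_valueAtOne)
    (hunit : ∀ [NeZero (((⟨1, 1, 0, -113, -552⟩ : WeierstrassCurve ℤ).baseChange ℚ).conductorNorm ℤ)] (q : ℕ) [Fact q.Prime] (K : Type) [Field K] [NumberField K]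
      (Dt : ModularParametrizationData ((⟨1, 1, 0, -113, -552⟩ : WeierstrassCurve ℤ).baseChange ℚ) (((⟨1, 1, 0, -113, -552⟩ : WeierstrassCurve ℤ).baseChange ℚ).conductorNorm ℤ))
      (H : HeegnerDatum (((⟨1, 1, 0, -113, -552⟩ : WeierstrassCurve ℤ).baseChange ℚ).conductorNorm ℤ) (NumberField.discr K)) (w₀ : InfinitePlace K)
      (P : (((⟨1, 1, 0, -113, -552⟩ : WeierstrassCurve ℤ).baseChange ℚ).baseChange K).toAffine.Point), ErratumHypotheses ((⟨1, 1, 0, -113, -552⟩ : WeierstrassCurve ℤ).baseChange ℚ) 5 → ((⟨1, 1, 0, -113, -552⟩ : WeierstrassCurve ℤ).baseChange ℚ).analyticRank = 1 →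
      q ≠ 5 → Mult ((⟨1, 1, 0, -113, -552⟩ : WeierstrassCurve ℤ).baseChange ℚ) q → ¬ ((⟨1, 1, 0, -113, -552⟩ : WeierstrassCurve ℤ).baseChange ℚ).HasSplitMultiplicativeReductionAtPrime q →
      ¬ 5 ∣ padicValInt q ((⟨1, 1, 0, -113, -552⟩ : WeierstrassCurve ℤ).baseChange ℚ).minimalDiscriminantInt → IsErratumField ((⟨1, 1, 0, -113, -552⟩ : WeierstrassCurve ℤ).baseChange ℚ) K q → NumberField.discr K = -231 →
      Cas20Standing K 5 (((⟨1, 1, 0, -113, -552⟩ : WeierstrassCurve ℤ).baseChange ℚ).conductorNorm ℤ / 5) →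
      WeierstrassCurve.Affine.Point.map w₀.embedding.toRatAlgHom P = heegnerPointComplex Dt H →
      ¬ (5 : ℤ) ∣ Dt.c → ¬ IsOfFinAddOrder P →
      ∀ (κ : ZpExtension K 5), κ.IsAnticyclotomic →
        ∀ (γ : Field.absoluteGaloisGroup K) [Fact (κ.IsTopGenerator γ)] (ι' : PadicAlgCl 5 ≃+* ℂ)
          (e : K →+* ℚ_[5]),
          (∀ k : 𝓞 K, k ∈ (primeOfEmbeddingDatum 5 ι' w₀.embedding).asIdeal ↔ ‖e (k : K)‖ < 1) →
          ‖((1 : ℚ_[5]) - (((⟨1, 1, 0, -113, -552⟩ : WeierstrassCurve ℤ).baseChange ℚ).LFunction 5 : ℚ_[5]) * (5 : ℚ_[5])⁻¹) *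
            logOmega ((⟨1, 1, 0, -113, -552⟩ : WeierstrassCurve ℤ).baseChange ℚ) 5 e P‖ = 1) :
    Summit.BirchSwinnertonDyer.Rank1Residual.X11b.P2.IMCDivIntCoreFrameAtDiscr
      ((⟨1, 1, 0, -113, -552⟩ : WeierstrassCurve ℤ).baseChange ℚ) 5 (-231) := by
  sorry

/-! ## Stub statements by name -/

namespace Statement

/-- Statement of `stub_imcDivErratum_nonsplitAtP`. -/
abbrev stub_imcDivErratum_nonsplitAtP : Prop := type_of% @Birth.stub_imcDivErratum_nonsplitAtP
/-- Statement of `stub_imcDivErratum_splitAtP`. -/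
abbrev stub_imcDivErratum_splitAtP : Prop := type_of% @Birth.stub_imcDivErratum_splitAtP
/-- Statement of `stub_rung_imcDivErratum_5235a1_d231` (certified BC5 rung; not used by `IMCDivAtErratumDataAll_of`). -/
abbrev stub_rung_imcDivErratum_5235a1_d231 : Prop := type_of% @Birth.stub_rung_imcDivErratum_5235a1_d231

end Statement

/-! ## The composition (sorry-free): the two reduction-type stub STATEMENTS imply the crux, BY NAME -/

/-- **`IMCDivAtErratumDataAll_of`** — H3♭-all from its non-split and split pieces: case split on
`W.HasSplitMultiplicativeReductionAtPrime p`. Pure logic. -/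
theorem IMCDivAtErratumDataAll_of (hN : Statement.stub_imcDivErratum_nonsplitAtP)
    (hS : Statement.stub_imcDivErratum_splitAtP) :
    Summit.BirchSwinnertonDyer.BirchSwinnertonDyer.Theses.ErratumRoadFive.IMCDivAtErratumDataAll := by
  intro W _ _ p _
  by_cases hs : W.HasSplitMultiplicativeReductionAtPrime p
  · exact hS W p hs
  · exact hN W p hs

/-- The crux along this line, MODULO exactly the two registered reduction-type stubs (sorries live only in `stub_*`). -/
theorem IMCDivAtErratumDataAll_proof :
    Summit.BirchSwinnertonDyer.BirchSwinnertonDyer.Theses.ErratumRoadFive.IMCDivAtErratumDataAll :=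
  IMCDivAtErratumDataAll_of stub_imcDivErratum_nonsplitAtP stub_imcDivErratum_splitAtP

end Summit.BirchSwinnertonDyer.BirchSwinnertonDyer.Cruxes.IMCDivAtErratumDataAll.Birth

end
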